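import Summits.RiemannHypothesis.RiemannHypothesis.Theorems.TiltedLandingLaw421R3LandingDoor

/-!
# lens-1 (rh33346) — the QUANTITATIVE Jensen dip lemma and the EDGE-dip successor (`succ_of_dip_edge`)

(CA449)(2) P-TARGET L-EDGE.  Ideation workfile (no registry change).  Nothing here bears on the truth of RH; RH is not proved;
33346/33347 OPEN.

* `jensenDipLog` — the Jensen dip SIGN lemma without the critical-point hypothesis: `g` entire of order `< 2`, `x` real, `g x ≠ 0`,
  `0 < Re ((g′/g)′(x))` ⇒ a zero `a` with `|x − Re a| < |Im a|` (Titchmarsh Lemma α differentiated once; pole terms `Re (−(x−a)⁻²) ≤ 0`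
  off the open Jensen cones).
* `jensenDip_quant` — the QUANTITATIVE version by ZERO REMOVAL: if every cone zero has `|Im a| ≥ h` and every list of cone zeros whose
  linear factors jointly divide `g` has length `≤ N` (= cone multiplicity budget), then `Re((g′/g)′(x))·h² ≤ N`.  Mechanism: divide out a
  cone zero (`dslope`; the class "entire of order < 2" is stable, `growth_dslope`), which raises `Re (q′/q)′(x)` by `Re (x−a)⁻² ≥ −1/Im a²
  ≥ −1/h²` (`re_inv_sq_ge`, `logDeriv2_factor`); after `N+1` removals the sign lemma still fires — contradiction with the budget.
* `succ_of_dip_edge` — frame corollary (`EngineHyps5 2 …`): a non-crossing dip of `f^{(j+1)}` at a real `xs` (`m = f^{(j+1)}(xs)`,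
  `f^{(j+2)}(xs) = 0`, `2A = f^{(j+3)}(xs)`, `0 < m·A`), a cone budget `N` at `xs`, a height `h > 0` with `N·|m| < 2·|A|·h²` and the
  lateral window clause `max(|xs − x₀| + h − R/2, 0)² + (j+1)·h² ≤ (j+1)·Hs²` ⇒ `∃ u, StTrkDQ … (j+1) u`.
  (With `N = 2`, i.e. one simple pair in the cone: `h > √(m/A)`; census (CA449): QDEEP 93/93 on TABLE S.)

Helpers `abs_re_lt_abs_im_of_re_inv_sq_neg`, `hasDerivAt_poleTerm` are IDENTICAL to the (3′) cut `RhW08.Lens1Coverage.*` (not yet landed);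
on landing after `…R3Lens1Coverage.lean`, delete them here and `open RhW08.Lens1Coverage`.
-/

set_option linter.unusedVariables false
set_option linter.unusedSectionVars false
set_option linter.style.longFile 0

namespace RhW08.Lens1Quant

noncomputable section

open Complex Set Filter Metric Topology
open scoped ComplexConjugate
open Literature.Analysis.Complex
open RhIdea6.G17.W07C7 RhIdea6.G17.W07C7.Rev6 RhIdea6.G18.W07C8.Law421BirthS RhIdea6.G19.W07C11.Seam
open RhIdea6.G20.W07C12.Frac RhIdea6.G20.W07C12.StColP RhW07.C12.FieldSplit RhIdea6.G21.W07C13.TentMax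
open RhW07.C14.TwoSided RhW07.C14.Classes RhW07.C14.Lineage RhW07.C14.Booking
open RhW07.C13.Heredity RhIdea6.G22.W07C15pre.Injection RhW07.E3.Cell RhW07.E3.Lit
open RhW08.Round1 RhW08.StSwap RhW08.Round2 RhW08.QuadW RhW08.SealSwapQ RhW08.SealSwap RhW08.SuccB RhW08.SuccSplit
open RhW08.ClusterQ RhW08.ClusterQM

/-! ## §0 Elementary helpers -/

/-- `Re (w²)⁻¹ < 0 ⟹ |Re w| < |Im w|` (the 45° cone).  [= `RhW08.Lens1Coverage.abs_re_lt_abs_im_of_re_inv_sq_neg`] -/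
theorem abs_re_lt_abs_im_of_re_inv_sq_neg {w : ℂ} (h : ((w ^ 2)⁻¹).re < 0) : |w.re| < |w.im| := by
  rw [Complex.inv_re] at h
  have hns : 0 ≤ Complex.normSq (w ^ 2) := Complex.normSq_nonneg _
  have hre : (w ^ 2).re = w.re ^ 2 - w.im ^ 2 := by
    rw [sq, Complex.mul_re]; ring
  have hneg : (w ^ 2).re < 0 := by
    by_contra hcon
    push Not at hcon
    have : 0 ≤ (w ^ 2).re / Complex.normSq (w ^ 2) := div_nonneg hcon hns
    linarith
  rw [hre] at hneg
  exact sq_lt_sq.1 (by linarith)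

/-- Lower bound of a pole term: `−1/(Im w)² ≤ Re (w²)⁻¹` (`Im w ≠ 0`). -/
theorem re_inv_sq_ge {w : ℂ} (hw : w.im ≠ 0) : -(1 / w.im ^ 2) ≤ ((w ^ 2)⁻¹).re := by
  rw [Complex.inv_re]
  have hre : (w ^ 2).re = w.re ^ 2 - w.im ^ 2 := by
    rw [sq, Complex.mul_re]; ring
  have hns : Complex.normSq (w ^ 2) = (w.re ^ 2 + w.im ^ 2) ^ 2 := by
    rw [map_pow, Complex.normSq_apply]; ring
  rw [hre, hns]
  have him2 : 0 < w.im ^ 2 := by positivity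
  have hden : 0 < (w.re ^ 2 + w.im ^ 2) ^ 2 := by positivity
  rw [neg_le, ← neg_div, div_le_div_iff₀ hden him2]
  nlinarith [sq_nonneg w.re, sq_nonneg w.im, mul_nonneg (sq_nonneg w.re) (sq_nonneg w.im)]

/-- The pole term `m/(z − a)` has derivative `−m/(x − a)²` at `x ≠ a`.  [= `RhW08.Lens1Coverage.hasDerivAt_poleTerm`] -/
theorem hasDerivAt_poleTerm (m : ℂ) {x a : ℂ} (hxa : x ≠ a) :
    HasDerivAt (fun z : ℂ => m / (z - a)) (-(m / (x - a) ^ 2)) x := by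
  have hsub : HasDerivAt (fun z : ℂ => z - a) 1 x := (hasDerivAt_id x).sub_const a
  have hne : x - a ≠ 0 := sub_ne_zero.2 hxa
  have hinv := hsub.inv hne
  have h := hinv.const_mul m
  have e : (fun z : ℂ => m / (z - a)) = fun z => m * (z - a)⁻¹ := by
    funext z; rw [div_eq_mul_inv]
  rw [e]
  refine h.congr_deriv ?_
  field_simp

/-- A growth bound forces a nonnegative constant. -/
theorem growthConst_nonneg {q : ℂ → ℂ} {ρ C : ℝ} (hqr : ∀ z, ‖q z‖ ≤ C * Real.exp (‖z‖ ^ ρ)) : 0 ≤ C := by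
  have h := hqr 0
  have hexp : 0 < Real.exp (‖(0 : ℂ)‖ ^ ρ) := Real.exp_pos _
  by_contra hC
  push Not at hC
  have : C * Real.exp (‖(0 : ℂ)‖ ^ ρ) < 0 := mul_neg_of_neg_of_pos hC hexp
  linarith [norm_nonneg (q 0)]

/-! ## §1 Zero removal keeps the class: `dslope` of an entire function of order `< 2` -/

/-- **ZERO REMOVAL.**  `q` entire with `‖q z‖ ≤ C e^{‖z‖^ρ}` and `q a = 0`: `r := dslope q a` is entire, `q z = (z − a)·r z`, and
`‖r z‖ ≤ C e^{(‖a‖+1)^ρ} · e^{‖z‖^ρ}` (maximum modulus on the unit circle about `a`; trivial outside it). -/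
theorem growth_dslope {q : ℂ → ℂ} (hq : Differentiable ℂ q) {ρ C : ℝ} (hρ0 : 0 ≤ ρ)
    (hqr : ∀ z, ‖q z‖ ≤ C * Real.exp (‖z‖ ^ ρ)) {a : ℂ} (ha : q a = 0) :
    Differentiable ℂ (dslope q a) ∧ (∀ z, q z = (z - a) * dslope q a z) ∧
      ∀ z, ‖dslope q a z‖ ≤ (C * Real.exp ((‖a‖ + 1) ^ ρ)) * Real.exp (‖z‖ ^ ρ) := by
  have hC : 0 ≤ C := growthConst_nonneg hqr
  have hd : Differentiable ℂ (dslope q a) := by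
    have h := (Complex.differentiableOn_dslope (univ_mem : (univ : Set ℂ) ∈ 𝓝 a)).2 hq.differentiableOn
    exact differentiableOn_univ.1 h
  have hfac : ∀ z, q z = (z - a) * dslope q a z := by
    intro z
    have h := sub_smul_dslope q a z
    rw [smul_eq_mul, ha, sub_zero] at h
    exact h.symm
  refine ⟨hd, hfac, ?_⟩
  -- the bound on the unit circle about `a`
  set C' : ℝ := C * Real.exp ((‖a‖ + 1) ^ ρ) with hC'
  have hC'C : C ≤ C' := by
    have : 1 ≤ Real.exp ((‖a‖ + 1) ^ ρ) := Real.one_le_exp (by positivity)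
    nlinarith
  have hsphere : ∀ w ∈ sphere a 1, ‖dslope q a w‖ ≤ C' := by
    intro w hw
    have hw1 : ‖w - a‖ = 1 := by simpa [dist_eq_norm] using hw
    have hqw : ‖q w‖ = ‖dslope q a w‖ := by
      rw [hfac w, norm_mul, hw1, one_mul]
    have hwn : ‖w‖ ≤ ‖a‖ + 1 := by
      calc ‖w‖ = ‖(w - a) + a‖ := by ring_nf
        _ ≤ ‖w - a‖ + ‖a‖ := norm_add_le _ _
        _ = ‖a‖ + 1 := by rw [hw1]; ring
    have hmono : Real.exp (‖w‖ ^ ρ) ≤ Real.exp ((‖a‖ + 1) ^ ρ) :=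
      Real.exp_le_exp.2 (Real.rpow_le_rpow (norm_nonneg _) hwn hρ0)
    calc ‖dslope q a w‖ = ‖q w‖ := hqw.symm
      _ ≤ C * Real.exp (‖w‖ ^ ρ) := hqr w
      _ ≤ C * Real.exp ((‖a‖ + 1) ^ ρ) := mul_le_mul_of_nonneg_left hmono hC
  intro z
  have hone : (1 : ℝ) ≤ Real.exp (‖z‖ ^ ρ) := Real.one_le_exp (by positivity)
  have hC'0 : 0 ≤ C' := le_trans hC hC'C
  by_cases hz : ‖z - a‖ < 1
  · -- inside: maximum modulus
    have hin : ‖dslope q a z‖ ≤ C' := by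
      refine Complex.norm_le_of_forall_mem_frontier_norm_le (isBounded_ball (x := a) (r := 1))
        (hd.diffContOnCl) (fun w hw => hsphere w ?_) (subset_closure (mem_ball_iff_norm.2 hz))
      rwa [frontier_ball a one_ne_zero] at hw
    calc ‖dslope q a z‖ ≤ C' := hin
      _ = C' * 1 := (mul_one _).symm
      _ ≤ C' * Real.exp (‖z‖ ^ ρ) := mul_le_mul_of_nonneg_left hone hC'0
  · -- outside: `‖r z‖ = ‖q z‖/‖z − a‖ ≤ ‖q z‖`
    push Not at hz
    have hza : 0 < ‖z - a‖ := lt_of_lt_of_le one_pos hz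
    have hle : ‖dslope q a z‖ ≤ ‖q z‖ := by
      rw [hfac z, norm_mul]
      calc ‖dslope q a z‖ = 1 * ‖dslope q a z‖ := (one_mul _).symm
        _ ≤ ‖z - a‖ * ‖dslope q a z‖ := mul_le_mul_of_nonneg_right hz (norm_nonneg _)
    calc ‖dslope q a z‖ ≤ ‖q z‖ := hle
      _ ≤ C * Real.exp (‖z‖ ^ ρ) := hqr z
      _ ≤ C' * Real.exp (‖z‖ ^ ρ) := mul_le_mul_of_nonneg_right hC'C (le_trans zero_le_one hone)

/-! ## §2 One removal shifts `(q′/q)′` by the pole term -/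

/-- If `q z = (z − a)·r z` (`q, r` entire, `q x ≠ 0`) then `(r′/r)′(x) = (q′/q)′(x) + (x − a)⁻²`. -/
theorem logDeriv2_factor {q r : ℂ → ℂ} (hq : Differentiable ℂ q) (hr : Differentiable ℂ r) {a x : ℂ}
    (hqr : ∀ z, q z = (z - a) * r z) (hx : q x ≠ 0) :
    deriv (fun z => deriv r z / r z) x = deriv (fun z => deriv q z / q z) x + 1 / (x - a) ^ 2 := by
  have hxa : x ≠ a := by
    intro h; apply hx; rw [hqr x, h, sub_self, zero_mul]
  -- `q′ = r + (z − a) r′`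
  have hdq : ∀ z, deriv q z = r z + (z - a) * deriv r z := by
    intro z
    have h : HasDerivAt (fun w => (w - a) * r w) (1 * r z + (z - a) * deriv r z) z :=
      ((hasDerivAt_id z).sub_const a).mul (hr.differentiableAt.hasDerivAt)
    have e : q = fun w => (w - a) * r w := funext hqr
    rw [e, h.deriv, one_mul]
  -- `r′/r = q′/q − 1/(z − a)` near `x`
  have hne_nhds : ∀ᶠ z in 𝓝 x, q z ≠ 0 := (hq.continuous.continuousAt (x := x)).eventually_ne hx
  have hEq : (fun z => deriv r z / r z) =ᶠ[𝓝 x] fun z => deriv q z / q z - 1 / (z - a) := by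
    filter_upwards [hne_nhds] with z hz
    have hza : z - a ≠ 0 := by
      intro h; apply hz; rw [hqr z, h, zero_mul]
    have hrz : r z ≠ 0 := by
      intro h; apply hz; rw [hqr z, h, mul_zero]
    rw [hdq z, hqr z]
    field_simp
    ring
  -- differentiate the right-hand side at `x`
  have hdq' : Differentiable ℂ (deriv q) := by
    have := differentiable_iteratedDeriv_of_entire hq 1
    simpa [iteratedDeriv_one] using this
  have h1 : HasDerivAt (fun z => deriv q z / q z) (deriv (fun z => deriv q z / q z) x) x :=
    ((hdq'.differentiableAt (x := x)).div (hq.differentiableAt) hx).hasDerivAt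
  have h2 : HasDerivAt (fun z : ℂ => 1 / (z - a)) (-(1 / (x - a) ^ 2)) x := hasDerivAt_poleTerm 1 hxa
  have h12 : HasDerivAt (fun z => deriv q z / q z - 1 / (z - a))
      (deriv (fun z => deriv q z / q z) x - -(1 / (x - a) ^ 2)) x := h1.sub h2
  rw [hEq.deriv_eq, h12.deriv]
  ring

/-! ## §3 The Jensen dip SIGN lemma for `(g′/g)′` -/

/-- **JENSEN DIP LEMMA (log-derivative form).**  `g` entire, `‖g z‖ ≤ C e^{‖z‖^ρ}` (`0 ≤ ρ < 2`); at a real `x` with `g x ≠ 0` and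
`0 < Re ((g′/g)′(x))` there is a zero `a` of `g` whose open Jensen cone contains `x`: `|x − Re a| < |Im a|`.
[Jensen 1913 / Pólya; Titchmarsh1986 §3.9 Lemma α differentiated once.] -/
theorem jensenDipLog {g : ℂ → ℂ} (hg : Differentiable ℂ g) {ρ C : ℝ} (hρ0 : 0 ≤ ρ) (hρ : ρ < 2)
    (hgr : ∀ z, ‖g z‖ ≤ C * Real.exp (‖z‖ ^ ρ)) {x : ℝ} (hx : g x ≠ 0)
    (hx2 : 0 < (deriv (fun z => deriv g z / g z) x).re) :
    ∃ a : ℂ, g a = 0 ∧ |x - a.re| < |a.im| := by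
  classical
  have hCpos : 0 < C := growthConst_pos hgr hx
  have hgx : 0 < ‖g (x : ℂ)‖ := norm_pos_iff.2 hx
  set δ : ℝ := (deriv (fun z => deriv g z / g z) x).re with hδ
  set K : ℝ := Real.log C - Real.log ‖g (x : ℂ)‖ + 1 with hK
  have hlim : Tendsto (fun R : ℝ ↦ 64 * ((K + (|x| + 2 * R) ^ ρ) / R ^ 2)) atTop (𝓝 0) := by
    simpa using (tendsto_growth_div_sq K x hρ0 hρ).const_mul 64
  obtain ⟨R, hRδ, hRge⟩ := ((hlim.eventually_lt_const hx2).and (eventually_ge_atTop (1 : ℝ))).exists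
  have hRpos : 0 < R := by linarith
  set M : ℝ := C * Real.exp ((|x| + 2 * R) ^ ρ) with hM
  obtain ⟨S, m, ψ, hS, hS', hψd, hψeq, -, hψ'⟩ :=
    titchmarsh_logDeriv_sub_sum hg hx hRpos (norm_le_on_closedBall hρ0 hgr x R)
  have hlog : Real.log (M / ‖g (x : ℂ)‖) + 1 = K + (|x| + 2 * R) ^ ρ := by
    rw [hK, hM, Real.log_div (by positivity) hgx.ne', Real.log_mul hCpos.ne' (Real.exp_pos _).ne',
      Real.log_exp]
    ring
  have hxS : ∀ a ∈ S, (x : ℂ) ≠ a := by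
    intro a ha hxa; exact hx (by rw [hxa]; exact (hS a ha).1)
  have hball : ball (x : ℂ) R ∈ 𝓝 (x : ℂ) := isOpen_ball.mem_nhds (mem_ball_self hRpos)
  have hne_nhds : ∀ᶠ z in 𝓝 (x : ℂ), g z ≠ 0 :=
    (hg.continuous.continuousAt (x := (x : ℂ))).eventually_ne hx
  have hEq : (fun z => deriv g z / g z) =ᶠ[𝓝 (x : ℂ)] fun z => (∑ a ∈ S, (m a : ℂ) / (z - a)) + ψ z := by
    filter_upwards [hball, hne_nhds] with z hz hz0
    rw [hψeq z hz hz0]; ring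
  have hR : HasDerivAt (fun z => (∑ a ∈ S, (m a : ℂ) / (z - a)) + ψ z)
      ((∑ a ∈ S, -((m a : ℂ) / (x - a) ^ 2)) + deriv ψ x) x := by
    have hsum : HasDerivAt (fun z => ∑ a ∈ S, (m a : ℂ) / (z - a)) (∑ a ∈ S, -((m a : ℂ) / (x - a) ^ 2)) x := by
      have h := HasDerivAt.sum (fun a ha => hasDerivAt_poleTerm (m a : ℂ) (hxS a ha))
      rwa [Finset.sum_fn] at h
    have hψx : HasDerivAt ψ (deriv ψ x) x :=
      (hψd.differentiableAt hball).hasDerivAt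
    exact hsum.add hψx
  have hderiv_eq : deriv (fun z => deriv g z / g z) x = (∑ a ∈ S, -((m a : ℂ) / (x - a) ^ 2)) + deriv ψ x := by
    rw [hEq.deriv_eq]; exact hR.deriv
  by_contra hcone
  push Not at hcone
  have hterm : ∀ a ∈ S, 0 ≤ ((m a : ℂ) / ((x : ℂ) - a) ^ 2).re := by
    intro a ha
    have hma : ((m a : ℂ) / ((x : ℂ) - a) ^ 2) = (m a : ℝ) * (((x : ℂ) - a) ^ 2)⁻¹ := by
      rw [div_eq_mul_inv]; norm_cast
    rw [hma, Complex.re_ofReal_mul]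
    apply mul_nonneg (Nat.cast_nonneg _)
    by_contra hneg
    push Not at hneg
    have hc := abs_re_lt_abs_im_of_re_inv_sq_neg hneg
    have : |x - a.re| < |a.im| := by simpa using hc
    exact absurd this (not_lt.2 (hcone a (hS a ha).1))
  have hre : δ = (∑ a ∈ S, -((m a : ℂ) / (x - a) ^ 2)).re + (deriv ψ x).re := by
    rw [hδ, hderiv_eq, Complex.add_re]
  rw [Complex.re_sum] at hre
  have hsum_nonpos : ∑ a ∈ S, (-((m a : ℂ) / ((x : ℂ) - a) ^ 2)).re ≤ 0 := by
    apply Finset.sum_nonpos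
    intro a ha
    rw [Complex.neg_re]
    linarith [hterm a ha]
  have hψre : (deriv ψ x).re ≤ 64 * ((K + (|x| + 2 * R) ^ ρ) / R ^ 2) := by
    have hxin : (x : ℂ) ∈ closedBall (x : ℂ) (R / 8) := mem_closedBall_self (by linarith)
    calc (deriv ψ x).re ≤ ‖deriv ψ x‖ := Complex.re_le_norm _
      _ ≤ 64 * (Real.log (M / ‖g (x : ℂ)‖) + 1) / R ^ 2 := hψ' _ hxin
      _ = 64 * ((K + (|x| + 2 * R) ^ ρ) / R ^ 2) := by rw [hlog]; ring
  have : δ < δ := by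
    calc δ = _ := hre
      _ ≤ 0 + 64 * ((K + (|x| + 2 * R) ^ ρ) / R ^ 2) := add_le_add hsum_nonpos hψre
      _ < δ := by rw [zero_add]; exact hRδ
  exact lt_irrefl _ this

/-! ## §4 The quantitative Jensen dip (zero removal) -/

/-- **QUANTITATIVE JENSEN DIP.**  `g` entire of order `< 2`, `x` real, `g x ≠ 0`; every zero in the open Jensen cone over `x` has
height `≥ h > 0`, and every list of cone zeros whose linear factors jointly divide `g` has length `≤ N` (cone multiplicity budget).
Then `Re ((g′/g)′(x)) · h² ≤ N`. -/
theorem jensenDip_quant {g : ℂ → ℂ} (hg : Differentiable ℂ g) {ρ C : ℝ} (hρ0 : 0 ≤ ρ) (hρ : ρ < 2)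
    (hgr : ∀ z, ‖g z‖ ≤ C * Real.exp (‖z‖ ^ ρ)) {x : ℝ} (hx : g x ≠ 0) {h : ℝ} (hh : 0 < h)
    (hcone : ∀ a, g a = 0 → |x - a.re| < |a.im| → h ≤ |a.im|) {N : ℕ}
    (hN : ∀ A : List ℂ, (∀ a ∈ A, g a = 0 ∧ |x - a.re| < |a.im|) →
      (∃ q : ℂ → ℂ, Differentiable ℂ q ∧ ∀ z, g z = (A.map (fun a => z - a)).prod * q z) → A.length ≤ N) :
    (deriv (fun z => deriv g z / g z) x).re * h ^ 2 ≤ N := by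
  set δ : ℝ := (deriv (fun z => deriv g z / g z) x).re with hδ
  by_contra hlt
  push Not at hlt
  have hh2 : 0 < h ^ 2 := by positivity
  -- k removals, k ≤ N + 1
  have key : ∀ k : ℕ, k ≤ N + 1 → ∃ (A : List ℂ) (q : ℂ → ℂ) (C' : ℝ), A.length = k ∧
      (∀ a ∈ A, g a = 0 ∧ |x - a.re| < |a.im|) ∧ Differentiable ℂ q ∧
      (∀ z, ‖q z‖ ≤ C' * Real.exp (‖z‖ ^ ρ)) ∧ (∀ z, g z = (A.map (fun a => z - a)).prod * q z) ∧
      δ - k / h ^ 2 ≤ (deriv (fun z => deriv q z / q z) x).re := by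
    intro k
    induction k with
    | zero =>
      intro _
      refine ⟨[], g, C, rfl, by simp, hg, hgr, fun z => by simp, ?_⟩
      simp [hδ]
    | succ k ih =>
      intro hk
      obtain ⟨A, q, C', hlen, hmem, hqd, hqg, hfac, hbd⟩ := ih (by omega)
      -- `q x ≠ 0` and the sign lemma fires for `q`
      have hqx : q x ≠ 0 := by
        intro h0; apply hx; rw [hfac x, h0, mul_zero]
      have hkN : (k : ℝ) ≤ N := by exact_mod_cast (by omega : k ≤ N)
      have hpos : 0 < (deriv (fun z => deriv q z / q z) x).re := by
        have : (k : ℝ) / h ^ 2 < δ := by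
          rw [div_lt_iff₀ hh2]; linarith
        linarith
      obtain ⟨a, ha, hca⟩ := jensenDipLog hqd hρ0 hρ hqg hqx hpos
      have hga : g a = 0 := by rw [hfac a, ha, mul_zero]
      have haim : h ≤ |a.im| := hcone a hga hca
      have haim0 : a.im ≠ 0 := by
        intro h0; rw [h0, abs_zero] at haim; linarith
      -- remove `a`
      obtain ⟨hrd, hqr, hrg⟩ := growth_dslope hqd hρ0 hqg ha
      refine ⟨a :: A, dslope q a, C' * Real.exp ((‖a‖ + 1) ^ ρ), by simp [hlen], ?_, hrd, hrg, ?_, ?_⟩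
      · intro b hb
        rcases List.mem_cons.1 hb with h' | h'
        · rw [h']; exact ⟨hga, hca⟩
        · exact hmem b h'
      · intro z
        rw [hfac z, hqr z, List.map_cons, List.prod_cons]
        ring
      · have hshift := logDeriv2_factor hqd hrd hqr hqx
        have hpole : -(1 / h ^ 2) ≤ ((1 : ℂ) / ((x : ℂ) - a) ^ 2).re := by
          have hw : ((x : ℂ) - a).im ≠ 0 := by simpa using haim0
          have h1 := re_inv_sq_ge hw
          have e : ((1 : ℂ) / ((x : ℂ) - a) ^ 2) = (((x : ℂ) - a) ^ 2)⁻¹ := one_div _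
          rw [e]
          refine le_trans ?_ h1
          have him : ((x : ℂ) - a).im = -a.im := by simp
          rw [him, neg_sq]
          have hsq : h ^ 2 ≤ a.im ^ 2 := by
            have := sq_le_sq' (by linarith [abs_nonneg a.im]) haim
            simpa [sq_abs] using this
          have ha2 : 0 < a.im ^ 2 := by positivity
          rw [neg_le_neg_iff, one_div_le_one_div ha2 hh2]
          exact hsq
        rw [hshift, Complex.add_re]
        push_cast
        rw [add_div, sub_add_eq_sub_sub]
        linarith
  obtain ⟨A, q, C', hlen, hmem, hqd, hqg, hfac, -⟩ := key (N + 1) le_rfl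
  have := hN A hmem ⟨q, hqd, hfac⟩
  omega

/-! ## §5 The EDGE-dip successor in the frame -/

/-- **EDGE-DIP SUCCESSOR.**  Frame `EngineHyps5 2 …`; a non-crossing dip of `f^{(j+1)}` at a real `xs` (`m = f^{(j+1)}(xs)`,
`f^{(j+2)}(xs) = 0`, `2A = f^{(j+3)}(xs)`, `0 < m·A`); a cone multiplicity budget `N` at `xs` (every list of cone zeros of `f^{(j+1)}`
whose linear factors jointly divide it has length `≤ N`); a height `h > 0` with `N·|m| < 2·|A|·h²`; and the LATERAL window clause
`max(|xs − x₀| + h − R/2, 0)² + (j+1)·h² ≤ (j+1)·Hs²`.  Then level `j+1` carries a band state.  (Deep or edge alike; for `N = 2`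
the height condition reads `h² > m/A`.) -/
theorem succ_of_dip_edge {η : ℝ} {f : ℂ → ℂ} {x₀ s hmax R Hs : ℝ} {B j : ℕ}
    (hE : EngineHyps5 2 η f x₀ s hmax R Hs B) {xs m A : ℝ}
    (hm : (m : ℂ) = iteratedDeriv (j + 1) f xs) (h2 : iteratedDeriv (j + 2) f xs = 0)
    (hA : ((2 * A : ℝ) : ℂ) = iteratedDeriv (j + 3) f xs) (hmA : 0 < m * A)
    {N : ℕ} (hN : ∀ L : List ℂ, (∀ a ∈ L, iteratedDeriv (j + 1) f a = 0 ∧ |xs - a.re| < |a.im|) →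
      (∃ q : ℂ → ℂ, Differentiable ℂ q ∧ ∀ z, iteratedDeriv (j + 1) f z = (L.map (fun a => z - a)).prod * q z) →
      L.length ≤ N)
    {h : ℝ} (hh : 0 < h) (hNh : (N : ℝ) * |m| < 2 * |A| * h ^ 2)
    (hwin : (max (|xs - x₀| + h - R / 2) 0) ^ 2 + ((j : ℝ) + 1) * h ^ 2 ≤ ((j : ℝ) + 1) * Hs ^ 2) :
    ∃ u : ℂ, StTrkDQ η f x₀ s hmax R Hs B (j + 1) u := by
  obtain ⟨hdiff, hreal, hgrowth, hs, hsh, hhR, h3R, hHs, hstrip, hHsR, hpair, hcol, hhalf, hη0, hη1, hrem⟩ := hE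
  have hE' : EngineHyps5 2 η f x₀ s hmax R Hs B :=
    ⟨hdiff, hreal, hgrowth, hs, hsh, hhR, h3R, hHs, hstrip, hHsR, hpair, hcol, hhalf, hη0, hη1, hrem⟩
  set g : ℂ → ℂ := iteratedDeriv (j + 1) f with hg_def
  have hgd : Differentiable ℂ g := differentiable_iteratedDeriv_of_entire hdiff (j + 1)
  have hC0 : InClass f Hs := ⟨hdiff, hreal, hgrowth, hstrip⟩
  have hm0 : m ≠ 0 := by
    intro h0; rw [h0, zero_mul] at hmA; exact lt_irrefl _ hmA
  have hgx : g xs ≠ 0 := by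
    rw [← hm]; exact_mod_cast hm0
  have hgne : g ≠ 0 := by
    intro h0; exact hgx (by rw [h0]; rfl)
  have hCj : InClass g Hs := analyticHeredity_landed f Hs (j + 1) hHs hC0 hgne
  obtain ⟨ρ', C', hρ'0, hρ', -, hgr'⟩ := StubAnalyticHeredity.growth_treeForm hgd hCj.2.2.1
  -- `(g′/g)′(xs) = g″(xs)/g(xs) = 2A/m`
  have hdg : Differentiable ℂ (deriv g) := by
    have := differentiable_iteratedDeriv_of_entire hgd 1
    simpa [iteratedDeriv_one] using this
  have hx1 : deriv g xs = 0 := by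
    rw [hg_def, ← iteratedDeriv_succ]; exact h2
  have hL : deriv (fun z => deriv g z / g z) xs = deriv (deriv g) xs / g xs := by
    have h : HasDerivAt (fun z => deriv g z / g z)
        ((deriv (deriv g) xs * g xs - deriv g xs * deriv g xs) / g xs ^ 2) xs :=
      (hdg.differentiableAt.hasDerivAt (x := (xs : ℂ))).div (hgd.differentiableAt.hasDerivAt) hgx
    rw [h.deriv, hx1]; field_simp; ring
  have hδ : (deriv (fun z => deriv g z / g z) xs).re = 2 * A / m := by
    have e : deriv (deriv g) = iteratedDeriv (j + 3) f := by
      rw [hg_def, ← iteratedDeriv_succ, ← iteratedDeriv_succ]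
    rw [hL, e, ← hA, ← hm, ← Complex.ofReal_div, Complex.ofReal_re]
  -- `δ·h² > N`
  have hδh : (N : ℝ) < (deriv (fun z => deriv g z / g z) xs).re * h ^ 2 := by
    rw [hδ]
    have hAm : 2 * A / m = 2 * |A| / |m| := by
      rcases lt_or_gt_of_ne hm0 with hneg | hpos
      · have hA' : A < 0 := by nlinarith
        rw [abs_of_neg hneg, abs_of_neg hA']; ring
      · have hA' : 0 < A := by nlinarith
        rw [abs_of_pos hpos, abs_of_pos hA']
    rw [hAm]
    have hmpos : 0 < |m| := abs_pos.2 hm0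
    rw [div_mul_eq_mul_div, lt_div_iff₀ hmpos]
    linarith
  -- hence a cone zero of height `< h`
  have hex : ∃ a, g a = 0 ∧ |xs - a.re| < |a.im| ∧ |a.im| < h := by
    by_contra hcon
    push Not at hcon
    have := jensenDip_quant hgd hρ'0 hρ' hgr' hgx hh (fun a ha hc => hcon a ha hc) hN
    linarith
  obtain ⟨a, ha, hca, hah⟩ := hex
  have haim : a.im ≠ 0 := by
    intro h0; rw [h0, abs_zero] at hca; exact absurd hca (not_lt.2 (abs_nonneg _))
  obtain ⟨u, hu, hup, hure, huim⟩ := exists_upper_zero_of_nonreal hdiff hreal (j + 1) ha haim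
  -- the lateral band clause for `u`
  have huim' : u.im < h := by
    have : |u.im| < h := by rw [huim]; exact hah
    rwa [abs_of_pos hup] at this
  have hure' : |u.re - x₀| ≤ |xs - x₀| + h := by
    have h1 : |u.re - x₀| ≤ |xs - u.re| + |xs - x₀| := by
      have := abs_sub_le (u.re) xs x₀
      rw [abs_sub_comm u.re xs] at this
      linarith
    have h2' : |xs - u.re| < |u.im| := by rw [hure, huim]; exact hca
    rw [abs_of_pos hup] at h2'
    linarith
  have hmax : max (|u.re - x₀| - R / 2) 0 ≤ max (|xs - x₀| + h - R / 2) 0 :=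
    max_le_max (by linarith) le_rfl
  have hmax0 : 0 ≤ max (|u.re - x₀| - R / 2) 0 := le_max_right _ _
  have hsq1 : (max (|u.re - x₀| - R / 2) 0) ^ 2 ≤ (max (|xs - x₀| + h - R / 2) 0) ^ 2 :=
    pow_le_pow_left₀ hmax0 hmax 2
  have hsq2 : u.im ^ 2 ≤ h ^ 2 := by nlinarith
  have hj0 : (0 : ℝ) ≤ (j : ℝ) + 1 := by positivity
  have hlat : (max (|u.re - x₀| - R / 2) 0) ^ 2 + (((j + 1 : ℕ) : ℝ)) * u.im ^ 2 ≤ (((j + 1 : ℕ) : ℝ)) * Hs ^ 2 := by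
    push_cast
    nlinarith [mul_le_mul_of_nonneg_left hsq2 hj0]
  exact ⟨u, stTrkDQ_of_lateral hE' hgne hu hup hlat⟩

end

end RhW08.Lens1Quant
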